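import Mathlib
import Summits.ValiantsHypothesis.ValiantsHypothesis.Theorems.DivisionGapPerMultiplesHardStubBlockProjection
import Summits.ValiantsHypothesis.ValiantsHypothesis.Theorems.DivisionGapPerMultiplesHardStubFaceDescent
import Literature.Computability.AlgebraicComplexity.ArithCircuitProofs
import Literature.Computability.AlgebraicComplexity.PermanentIrreducible

/-!
# `DivisionGap.PerMultiplesHard` (stmt-ValiantsHypothesis-5068), line `uncharged-face-walk`:
the block-projection lever AT A HOST (stub `stub_hostBlockProjection`)

Let `G ⊆ [n]²` be a host and `per_G = Σ_{σ ⊆ G} x^{μ_σ}` its face permanent.  Let `h ≠ 0` be a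
multiplier over `ℝ≥0` all of whose exponents have total degree `D`, and let `A` (rows) and `B`
(columns) be read through bijections `eA : Fin a ≃ A`, `eB : Fin a ≃ B`.  A cell `(x, y)` is
BLOCK-DIAGONAL when `x ∈ A ↔ y ∈ B`.  Suppose `h` has an exponent living on block-diagonal cells,
all such exponents agree with `u` on `A × B`, and `G` contains a block-diagonal permutation.  Then
for the transport `u'` of `u|_{A × B}` to the `a`-board and the induced host
`G' = {(x, y) : (eA x, eB y) ∈ G}`,

  `L⁺(x^{u'} · per_{G'}) ≤ L⁺(per_G · h) + 1`

for the tree's monotone fan-in-two `complexity` over `ℝ≥0`.  All moves are free over `ℝ≥0`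
(this is the landed `BlockProjection.stub_blockProjection` with `per_n` replaced by `per_G`):

1. TOP FORM for the indicator weight `w` of the block-diagonal cells (`topComponent_mul`,
   `complexity_topComponent_le`): the `w`-weight of `x^{μ_σ}` is `#{i : σ i ∈ A ↔ i ∈ B} ≤ n`
   with equality iff `σ` is block-diagonal, so `top_w per_G = Σ_{σ ⊆ G block-diagonal} x^{μ_σ}`
   (`topComponent_facePer_eq`; nonempty by hypothesis), and `top_w h` lives on block-diagonal
   cells (`RowConcentration.conc_of_mem_support_topComponent`).
2. ONE PROJECTION onto the `a`-board (`IsProjection.complexity_le_holds`): the cell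
   `(eA s, eB t)` goes to `X (s, t)`, every other cell to `1`.  Then `top_w h ↦ c · x^{u'}`,
   `c ≠ 0`, and `x^{μ_σ} ↦ x^{μ_π}` for the permutation `π = ind σ` of the `a`-board induced by a
   block-diagonal `σ` on `B → A`; `σ ⊆ G` iff `π ⊆ G'` and `σ ⊆ G` off the columns `B`.  FIBRE
   COUNT: right multiplication by the extension `ρ̂` of `ρ = π⁻¹ π₀` along `eB` is a bijection
   from the fibre of `ind` over `π` onto the fibre over `π₀` (for `π, π₀ ⊆ G'`), so all fibres
   have the same size `N ≠ 0` and `Σ_{σ ⊆ G block-diagonal} prj (x^{μ_σ}) = N · per_{G'}`.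
3. RESCALE by `(N c)⁻¹` (`complexity_smul_le_holds`, one gate).

Log (stub-worker): written on the landed `BlockProjection` / `FaceDescent` / `TopComponentFree`
API; playbook: none fit. [folklore]
-/

noncomputable section

open MvPolynomial Literature.Computability.AlgebraicComplexity
open scoped NNReal BigOperators
open Summit.ValiantsHypothesis.ValiantsHypothesis.Theorems.ZeroOneTransfer.Negative
open Summit.ValiantsHypothesis.ValiantsHypothesis.Theorems.DivisionGap.PerMultiplesHard.FaceDescent
  (sum_coeff_ne_zero weight_permMonomial)
open Summit.ValiantsHypothesis.ValiantsHypothesis.Theorems.DivisionGap.PerMultiplesHard.RowConcentration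
  (conc_of_mem_support_topComponent)
open Summit.ValiantsHypothesis.ValiantsHypothesis.Theorems.DivisionGap.PerMultiplesHard.BlockProjection
  (exists_induced blockDiag_mul_iff induced_mul_extendDomain aeval_prj_monomial
    aeval_prj_permMonomial)

namespace Summit.ValiantsHypothesis.ValiantsHypothesis.Theorems.DivisionGap.PerMultiplesHard.HostBlockProjection

variable {n a : ℕ} {A B : Finset (Fin n)}

/-! ### Sums of permutation monomials -/

/-- The coefficient of `x^{μ_ρ}` in `Σ_{σ ∈ S} x^{μ_σ}` is `[ρ ∈ S]`. [folklore] -/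
theorem coeff_sum_permMonomial (S : Finset (Equiv.Perm (Fin n))) (ρ : Equiv.Perm (Fin n)) :
    coeff (permMonomial ρ) (∑ σ ∈ S, monomial (permMonomial σ) (1 : ℝ≥0)) =
      if ρ ∈ S then 1 else 0 := by
  classical
  rw [coeff_sum]
  simp only [coeff_monomial]
  by_cases hρ : ρ ∈ S
  · rw [if_pos hρ, Finset.sum_eq_single ρ]
    · rw [if_pos rfl]
    · intro σ _ hσ
      rw [if_neg (permMonomial_injective.ne hσ)]
    · intro h
      exact absurd hρ h
  · rw [if_neg hρ]
    refine Finset.sum_eq_zero fun σ hσ => if_neg fun h => hρ ?_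
    obtain rfl : σ = ρ := permMonomial_injective h
    exact hσ

/-- The exponents of `Σ_{σ ∈ S} x^{μ_σ}` are the `μ_ρ`, `ρ ∈ S`. [folklore] -/
theorem exists_of_mem_support_sum_permMonomial (S : Finset (Equiv.Perm (Fin n)))
    {d : (Fin n × Fin n) →₀ ℕ} (hd : d ∈ (∑ σ ∈ S, monomial (permMonomial σ) (1 : ℝ≥0)).support) :
    ∃ ρ ∈ S, permMonomial ρ = d := by
  classical
  rw [mem_support_iff, coeff_sum] at hd
  obtain ⟨ρ, hρ, hne⟩ := Finset.exists_ne_zero_of_sum_ne_zero hd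
  rw [coeff_monomial] at hne
  exact ⟨ρ, hρ, of_not_not fun h => hne (if_neg h)⟩

/-! ### The block-diagonal indicator weight -/

/-- For the indicator weight of the block-diagonal cells, the weight of `x^{μ_ρ}` is
`#{i : ρ i ∈ A ↔ i ∈ B}`. [folklore] -/
theorem weight_bd_permMonomial (A B : Finset (Fin n)) (ρ : Equiv.Perm (Fin n)) :
    Finsupp.weight (fun e : Fin n × Fin n => if (e.1 ∈ A ↔ e.2 ∈ B) then 1 else 0)
        (permMonomial ρ) = (Finset.univ.filter fun i => (ρ i ∈ A ↔ i ∈ B)).card := by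
  rw [weight_permMonomial, Finset.card_filter]

/-- Hence this weight is at most `n`. [folklore] -/
theorem weight_bd_permMonomial_le (A B : Finset (Fin n)) (ρ : Equiv.Perm (Fin n)) :
    Finsupp.weight (fun e : Fin n × Fin n => if (e.1 ∈ A ↔ e.2 ∈ B) then 1 else 0)
        (permMonomial ρ) ≤ n := by
  rw [weight_bd_permMonomial]
  exact (Finset.card_filter_le _ _).trans (by rw [Finset.card_univ, Fintype.card_fin])

/-- And it equals `n` iff `ρ` is block-diagonal. [folklore] -/
theorem weight_bd_permMonomial_eq_iff (A B : Finset (Fin n)) (ρ : Equiv.Perm (Fin n)) :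
    Finsupp.weight (fun e : Fin n × Fin n => if (e.1 ∈ A ↔ e.2 ∈ B) then 1 else 0)
        (permMonomial ρ) = n ↔ ∀ i, (ρ i ∈ A ↔ i ∈ B) := by
  rw [weight_bd_permMonomial]
  constructor
  · intro h i
    have hu : (Finset.univ.filter fun i => (ρ i ∈ A ↔ i ∈ B)) = Finset.univ :=
      Finset.eq_univ_of_card _ (by rw [h, Fintype.card_fin])
    have hi := Finset.eq_univ_iff_forall.1 hu i
    simpa using hi
  · intro h
    rw [Finset.filter_true_of_mem (fun i _ => h i), Finset.card_univ, Fintype.card_fin]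

/-- **Top form of the face permanent.**  If `G` contains a block-diagonal permutation, the top
component of `per_G` for the block-diagonal indicator weight is the sum of `x^{μ_σ}` over the
block-diagonal `σ ⊆ G`. [folklore] -/
theorem topComponent_facePer_eq (A B : Finset (Fin n)) (G : Finset (Fin n × Fin n))
    {σ₀ : Equiv.Perm (Fin n)} (hσ₀G : ∀ i, (σ₀ i, i) ∈ G) (hσ₀ : ∀ i, (σ₀ i ∈ A ↔ i ∈ B)) :
    topComponent (fun e : Fin n × Fin n => if (e.1 ∈ A ↔ e.2 ∈ B) then 1 else 0)
        (∑ σ ∈ (Finset.univ : Finset (Equiv.Perm (Fin n))).filter (fun σ => ∀ i, (σ i, i) ∈ G),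
          monomial (permMonomial σ) (1 : ℝ≥0)) =
      ∑ σ ∈ (Finset.univ : Finset (Equiv.Perm (Fin n))).filter
          (fun σ => (∀ i, (σ i, i) ∈ G) ∧ ∀ i, (σ i ∈ A ↔ i ∈ B)),
        monomial (permMonomial σ) (1 : ℝ≥0) := by
  classical
  set w : Fin n × Fin n → ℕ := fun e => if (e.1 ∈ A ↔ e.2 ∈ B) then 1 else 0 with hw
  set perG : MvPolynomial (Fin n × Fin n) ℝ≥0 :=
    ∑ σ ∈ (Finset.univ : Finset (Equiv.Perm (Fin n))).filter (fun σ => ∀ i, (σ i, i) ∈ G),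
      monomial (permMonomial σ) (1 : ℝ≥0) with hperG
  have hdegG : weightedTotalDegree w perG = n := by
    refine le_antisymm (Finset.sup_le fun d hd => ?_) ?_
    · obtain ⟨ρ, -, rfl⟩ := exists_of_mem_support_sum_permMonomial _ hd
      exact weight_bd_permMonomial_le A B ρ
    · have hmem : permMonomial σ₀ ∈ perG.support := by
        rw [mem_support_iff, hperG, coeff_sum_permMonomial, if_pos (by simpa using hσ₀G)]
        exact one_ne_zero
      exact ((weight_bd_permMonomial_eq_iff A B σ₀).2 hσ₀).ge.trans (le_weightedTotalDegree w hmem)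
  refine MvPolynomial.ext _ _ fun d => ?_
  rw [coeff_topComponent, hdegG]
  by_cases hd : ∃ ρ : Equiv.Perm (Fin n), permMonomial ρ = d
  · obtain ⟨ρ, rfl⟩ := hd
    rw [hperG, coeff_sum_permMonomial, coeff_sum_permMonomial]
    simp only [Finset.mem_filter, Finset.mem_univ, true_and]
    by_cases h1 : ∀ i, (ρ i ∈ A ↔ i ∈ B)
    · rw [if_pos ((weight_bd_permMonomial_eq_iff A B ρ).2 h1)]
      by_cases h2 : ∀ i, (ρ i, i) ∈ G <;> simp [h1, h2]
    · rw [if_neg (fun h => h1 ((weight_bd_permMonomial_eq_iff A B ρ).1 h))]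
      simp [h1]
  · have h0 : ∀ S : Finset (Equiv.Perm (Fin n)),
        coeff d (∑ σ ∈ S, monomial (permMonomial σ) (1 : ℝ≥0)) = 0 := fun S => by
      by_contra hne
      obtain ⟨ρ, -, hρ⟩ := exists_of_mem_support_sum_permMonomial S (mem_support_iff.2 hne)
      exact hd ⟨ρ, hρ⟩
    rw [hperG, h0, h0, ite_self]

/-! ### The induced permutation of the `a`-board and the fibre count -/

section Induced

variable (eA : Fin a ≃ {x // x ∈ A}) (eB : Fin a ≃ {x // x ∈ B})

/-- A choice `ind` of induced permutations of the `a`-board: `eA (ind σ t) = σ (eB t)` for every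
block-diagonal `σ` (`BlockProjection.exists_induced`; junk elsewhere). [folklore] -/
theorem exists_ind : ∃ ind : Equiv.Perm (Fin n) → Equiv.Perm (Fin a),
    ∀ σ, (∀ i, (σ i ∈ A ↔ i ∈ B)) → ∀ t, (eA (ind σ t) : Fin n) = σ (eB t) := by
  classical
  refine ⟨fun σ => if hσ : ∀ i, (σ i ∈ A ↔ i ∈ B) then
    Classical.choose (exists_induced eA eB hσ) else 1, fun σ hσ t => ?_⟩
  simp only [dif_pos hσ]
  exact Classical.choose_spec (exists_induced eA eB hσ) t

variable {ind : Equiv.Perm (Fin n) → Equiv.Perm (Fin a)}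
  (hind : ∀ σ, (∀ i, (σ i ∈ A ↔ i ∈ B)) → ∀ t, (eA (ind σ t) : Fin n) = σ (eB t))
include hind

/-- Equivariance: `ind (σ · ρ̂) = ind σ · ρ` for the extension `ρ̂` of `ρ` along `eB`.
[folklore] -/
theorem ind_mul_extendDomain {σ : Equiv.Perm (Fin n)} (hσ : ∀ i, (σ i ∈ A ↔ i ∈ B))
    (ρ : Equiv.Perm (Fin a)) : ind (σ * ρ.extendDomain eB) = ind σ * ρ :=
  induced_mul_extendDomain eA eB (hind σ hσ) (hind _ ((blockDiag_mul_iff eB σ ρ).2 hσ))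

/-- A block-diagonal `σ` lies inside `G` iff it does so off the columns `B` and its induced
permutation lies inside the induced host `G'`. [folklore] -/
theorem forall_mem_iff_of_bd (G : Finset (Fin n × Fin n)) {σ : Equiv.Perm (Fin n)}
    (hσ : ∀ i, (σ i ∈ A ↔ i ∈ B)) :
    (∀ i, (σ i, i) ∈ G) ↔ (∀ i, i ∉ B → (σ i, i) ∈ G) ∧
      ∀ t, (((eA (ind σ t) : Fin n), (eB t : Fin n)) ∈ G) := by
  refine ⟨fun h => ⟨fun i _ => h i, fun t => by rw [hind σ hσ]; exact h _⟩, fun h i => ?_⟩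
  by_cases hi : i ∈ B
  · have ht := h.2 (eB.symm ⟨i, hi⟩)
    rwa [hind σ hσ, Equiv.apply_symm_apply] at ht
  · exact h.1 i hi

omit hind

/-- **Fibre count.**  Under a projection sending the cell `(eA s, eB t)` to `X (s, t)` and every
cell off `A × B` to `1`, `Σ_{σ ⊆ G block-diagonal} prj (x^{μ_σ}) = N · per_{G'}` with `N ≠ 0`,
provided `G` contains a block-diagonal permutation: `prj (x^{μ_σ}) = x^{μ_{ind σ}}`, and right
multiplication by `ρ̂`, `ρ = π⁻¹ π₀`, is a bijection between the fibres of `ind` over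
`π, π₀ ⊆ G'`. [folklore] -/
theorem sum_aeval_prj_eq (prj : Fin n × Fin n → MvPolynomial (Fin a × Fin a) ℝ≥0)
    (hpX : ∀ s t, prj ((eA s : Fin n), (eB t : Fin n)) = X (s, t))
    (hp1 : ∀ e : Fin n × Fin n, ¬ (e.1 ∈ A ∧ e.2 ∈ B) → prj e = 1)
    (G : Finset (Fin n × Fin n)) {σ₀ : Equiv.Perm (Fin n)} (hσ₀G : ∀ i, (σ₀ i, i) ∈ G)
    (hσ₀ : ∀ i, (σ₀ i ∈ A ↔ i ∈ B)) :
    ∃ N : ℕ, N ≠ 0 ∧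
      ∑ σ ∈ (Finset.univ : Finset (Equiv.Perm (Fin n))).filter
          (fun σ => (∀ i, (σ i, i) ∈ G) ∧ ∀ i, (σ i ∈ A ↔ i ∈ B)),
          aeval prj (monomial (permMonomial σ) (1 : ℝ≥0)) =
        (N : ℝ≥0) • ∑ σ ∈ (Finset.univ : Finset (Equiv.Perm (Fin a))).filter
            (fun σ => ∀ i, (((eA (σ i) : Fin n), (eB i : Fin n)) ∈ G)),
          monomial (permMonomial σ) (1 : ℝ≥0) := by
  classical
  obtain ⟨ind, hind⟩ := exists_ind eA eB
  set BDG := (Finset.univ : Finset (Equiv.Perm (Fin n))).filter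
    (fun σ => (∀ i, (σ i, i) ∈ G) ∧ ∀ i, (σ i ∈ A ↔ i ∈ B)) with hBDG
  set PG := (Finset.univ : Finset (Equiv.Perm (Fin a))).filter
    (fun σ => ∀ i, (((eA (σ i) : Fin n), (eB i : Fin n)) ∈ G)) with hPG
  have hmemPG : ∀ π, π ∈ PG ↔ ∀ t, (((eA (π t) : Fin n), (eB t : Fin n)) ∈ G) := fun π => by
    simp only [hPG, Finset.mem_filter, Finset.mem_univ, true_and]
  -- membership in a fibre over `π ⊆ G'`
  have hfib : ∀ {π : Equiv.Perm (Fin a)}, π ∈ PG → ∀ σ : Equiv.Perm (Fin n),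
      σ ∈ BDG.filter (fun σ => ind σ = π) ↔
        (∀ i, (σ i ∈ A ↔ i ∈ B)) ∧ (∀ i, i ∉ B → (σ i, i) ∈ G) ∧ ind σ = π := by
    intro π hπ σ
    simp only [hBDG, Finset.mem_filter, Finset.mem_univ, true_and]
    constructor
    · rintro ⟨⟨hG, hBD⟩, hπσ⟩
      exact ⟨hBD, fun i _ => hG i, hπσ⟩
    · rintro ⟨hBD, hG, hπσ⟩
      refine ⟨⟨(forall_mem_iff_of_bd eA eB hind G hBD).2 ⟨hG, fun t => ?_⟩, hBD⟩, hπσ⟩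
      rw [hπσ]
      exact (hmemPG π).1 hπ t
  -- all fibres over `PG` have the same size
  have hcard : ∀ {π π₀ : Equiv.Perm (Fin a)}, π ∈ PG → π₀ ∈ PG →
      (BDG.filter (fun σ => ind σ = π)).card = (BDG.filter (fun σ => ind σ = π₀)).card := by
    intro π π₀ hπ hπ₀
    refine Finset.card_equiv (Equiv.mulRight ((π⁻¹ * π₀).extendDomain eB)) fun σ => ?_
    rw [hfib hπ, hfib hπ₀, Equiv.coe_mulRight, blockDiag_mul_iff eB σ (π⁻¹ * π₀)]
    refine and_congr_right fun hBD => and_congr (forall_congr' fun i => ?_) ?_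
    · refine imp_congr_right fun hi => ?_
      rw [Equiv.Perm.mul_apply, Equiv.Perm.extendDomain_apply_not_subtype _ _ hi]
    · rw [ind_mul_extendDomain eA eB hind hBD, ← eq_mul_inv_iff_mul_eq]
      have hππ : π₀ * (π⁻¹ * π₀)⁻¹ = π := by group
      rw [hππ]
  -- the base fibre, through `σ₀`
  have hπ₀ : ind σ₀ ∈ PG := (hmemPG _).2 ((forall_mem_iff_of_bd eA eB hind G hσ₀).1 hσ₀G).2
  have hσ₀fib : σ₀ ∈ BDG.filter (fun σ => ind σ = ind σ₀) :=
    (hfib hπ₀ σ₀).2 ⟨hσ₀, fun i _ => hσ₀G i, rfl⟩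
  have hmaps : ∀ σ ∈ BDG, ind σ ∈ PG := fun σ hσ => by
    have h := (Finset.mem_filter.1 hσ).2
    exact (hmemPG _).2 ((forall_mem_iff_of_bd eA eB hind G h.2).1 h.1).2
  refine ⟨(BDG.filter (fun σ => ind σ = ind σ₀)).card, Finset.card_ne_zero.2 ⟨σ₀, hσ₀fib⟩, ?_⟩
  calc ∑ σ ∈ BDG, aeval prj (monomial (permMonomial σ) (1 : ℝ≥0))
      = ∑ σ ∈ BDG, monomial (permMonomial (ind σ)) (1 : ℝ≥0) :=
        Finset.sum_congr rfl fun σ hσ => aeval_prj_permMonomial eA eB prj hpX hp1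
          (hind σ (Finset.mem_filter.1 hσ).2.2)
    _ = ∑ π ∈ PG, ∑ σ ∈ BDG with ind σ = π, monomial (permMonomial π) (1 : ℝ≥0) :=
        (Finset.sum_fiberwise_of_maps_to' hmaps fun π => monomial (permMonomial π) (1 : ℝ≥0)).symm
    _ = ∑ π ∈ PG, ((BDG.filter (fun σ => ind σ = ind σ₀)).card : ℝ≥0) •
          monomial (permMonomial π) (1 : ℝ≥0) :=
        Finset.sum_congr rfl fun π hπ => by
          rw [Finset.sum_const, hcard hπ hπ₀, Nat.cast_smul_eq_nsmul]
    _ = _ := (Finset.smul_sum).symm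

end Induced

/-! ### The stub -/

/-- **Block projection at a host (stub `stub_hostBlockProjection` of line `uncharged-face-walk`).**
If `h ≠ 0` is homogeneous in total degree, some exponent of `h` lives on the block-diagonal cells
of `(A, B)` and all such exponents agree with `u` on `A × B`, and the host `G` contains a
block-diagonal permutation, then `L⁺(x^{u'} · per_{G'}) ≤ L⁺(per_G · h) + 1` for the transport
`u'` of `u|_{A × B}` along `(eA, eB)` and the induced host `G' = {(x, y) : (eA x, eB y) ∈ G}`: one
free top form (indicator weight of the block-diagonal cells), one free projection onto the
`a`-board (`top h ↦ c · x^{u'}`, `c ≠ 0`; `top per_G ↦ N · per_{G'}`, `N ≠ 0`, by the fibre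
count), and one rescaling gate. [folklore] -/
theorem stub_hostBlockProjection :
    ∀ (n : ℕ) (G : Finset (Fin n × Fin n)) (h : MvPolynomial (Fin n × Fin n) ℝ≥0), h ≠ 0 →
      ∀ (D : ℕ), (∀ d ∈ h.support, d.degree = D) →
      ∀ (A B : Finset (Fin n)) (u : (Fin n × Fin n) →₀ ℕ) (a : ℕ) (eA : Fin a ≃ {x // x ∈ A}) (eB : Fin a ≃ {x // x ∈ B}),
        ((∃ m ∈ h.support, ∀ e ∈ m.support, (e.1 ∈ A ↔ e.2 ∈ B)) ∧
          ∀ m ∈ h.support, (∀ e ∈ m.support, (e.1 ∈ A ↔ e.2 ∈ B)) → ∀ e : Fin n × Fin n, e.1 ∈ A → e.2 ∈ B → m e = u e) →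
        (∃ σ : Equiv.Perm (Fin n), (∀ i, (σ i, i) ∈ G) ∧ ∀ i, σ i ∈ A ↔ i ∈ B) →
        ∃ u' : (Fin a × Fin a) →₀ ℕ,
          complexity (monomial u' (1 : ℝ≥0) *
              ∑ σ ∈ (Finset.univ : Finset (Equiv.Perm (Fin a))).filter
                (fun σ => ∀ i, (((eA (σ i) : Fin n), (eB i : Fin n)) ∈ G)),
                monomial (permMonomial σ) (1 : ℝ≥0)) ≤
            complexity ((∑ σ ∈ (Finset.univ : Finset (Equiv.Perm (Fin n))).filter (fun σ => ∀ i, (σ i, i) ∈ G),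
              monomial (permMonomial σ) (1 : ℝ≥0)) * h) + 1 := by
  intro n G h hh D hdeg A B u a eA eB hyp hG
  classical
  obtain ⟨⟨m₀, hm₀, hm₀c⟩, hu⟩ := hyp
  obtain ⟨σ₀, hσ₀G, hσ₀⟩ := hG
  -- the transported exponent
  obtain ⟨u', hu'⟩ : ∃ u' : (Fin a × Fin a) →₀ ℕ, ∀ s t, u' (s, t) = u (eA s, eB t) :=
    ⟨Finsupp.equivFunOnFinite.symm fun pq => u (eA pq.1, eB pq.2), fun s t => rfl⟩
  refine ⟨u', ?_⟩
  set perG : MvPolynomial (Fin n × Fin n) ℝ≥0 :=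
    ∑ σ ∈ (Finset.univ : Finset (Equiv.Perm (Fin n))).filter (fun σ => ∀ i, (σ i, i) ∈ G),
      monomial (permMonomial σ) (1 : ℝ≥0) with hperG
  set perG' : MvPolynomial (Fin a × Fin a) ℝ≥0 :=
    ∑ σ ∈ (Finset.univ : Finset (Equiv.Perm (Fin a))).filter
      (fun σ => ∀ i, (((eA (σ i) : Fin n), (eB i : Fin n)) ∈ G)),
      monomial (permMonomial σ) (1 : ℝ≥0) with hperG'
  -- the projection, by specification
  obtain ⟨prj, hpX, hp1, hpP⟩ : ∃ prj : Fin n × Fin n → MvPolynomial (Fin a × Fin a) ℝ≥0,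
      (∀ s t, prj ((eA s : Fin n), (eB t : Fin n)) = X (s, t)) ∧
      (∀ e : Fin n × Fin n, ¬ (e.1 ∈ A ∧ e.2 ∈ B) → prj e = 1) ∧
      ∀ e, (∃ v, prj e = X v) ∨ ∃ c, prj e = C c := by
    refine ⟨fun e => if hx : e.1 ∈ A ∧ e.2 ∈ B then
      X (eA.symm ⟨e.1, hx.1⟩, eB.symm ⟨e.2, hx.2⟩) else 1, fun s t => ?_, fun e he => dif_neg he,
      fun e => ?_⟩
    · dsimp only
      rw [dif_pos ⟨(eA s).2, (eB t).2⟩]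
      simp
    · dsimp only
      by_cases he : e.1 ∈ A ∧ e.2 ∈ B
      · exact Or.inl ⟨_, dif_pos he⟩
      · exact Or.inr ⟨1, by rw [dif_neg he, C_1]⟩
  -- (1) the weight: top forms
  set w : Fin n × Fin n → ℕ := fun e => if (e.1 ∈ A ↔ e.2 ∈ B) then 1 else 0 with hw
  set BDG := (Finset.univ : Finset (Equiv.Perm (Fin n))).filter
    (fun σ => (∀ i, (σ i, i) ∈ G) ∧ ∀ i, (σ i ∈ A ↔ i ∈ B)) with hBDG
  have htopP : topComponent w perG = ∑ σ ∈ BDG, monomial (permMonomial σ) (1 : ℝ≥0) :=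
    topComponent_facePer_eq A B G hσ₀G hσ₀
  have hconcT : ∀ d ∈ (topComponent w h).support, ∀ e ∈ d.support, (e.1 ∈ A ↔ e.2 ∈ B) :=
    fun d hd => conc_of_mem_support_topComponent hdeg (fun e => (e.1 ∈ A ↔ e.2 ∈ B)) hm₀
      hm₀c hd
  -- (2) the images under the projection
  set c : ℝ≥0 := ∑ d ∈ (topComponent w h).support, coeff d (topComponent w h) with hc
  have hc0 : c ≠ 0 := sum_coeff_ne_zero (topComponent_ne_zero w hh)
  have htopH : aeval prj (topComponent w h) = C c * monomial u' 1 := by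
    conv_lhs => rw [(topComponent w h).as_sum]
    rw [map_sum, hc, map_sum, Finset.sum_mul]
    refine Finset.sum_congr rfl fun d hd => aeval_prj_monomial eA eB prj hpX hp1 (fun s t => ?_) _
    rw [hu', hu d (support_topComponent_subset w h hd) (hconcT d hd) _ (eA s).2 (eB t).2]
  obtain ⟨N, hN, hNeq⟩ := sum_aeval_prj_eq eA eB prj hpX hp1 G hσ₀G hσ₀
  have hS : aeval prj (topComponent w perG) = ((N : ℕ) : ℝ≥0) • perG' := by
    rw [htopP, map_sum]
    exact hNeq
  -- the scalar identity `(N c) • (x^{u'} per_{G'}) = prj (top (per_G h))`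
  set Gp := aeval prj (topComponent w (perG * h)) with hGp
  have hid : (((N : ℕ) : ℝ≥0) * c) • (monomial u' (1 : ℝ≥0) * perG') = Gp := by
    rw [hGp, topComponent_mul, map_mul, hS, htopH, smul_eq_C_mul, smul_eq_C_mul, map_mul]
    ring
  have hNc : ((N : ℕ) : ℝ≥0) * c ≠ 0 := mul_ne_zero (Nat.cast_ne_zero.2 hN) hc0
  have hκ : monomial u' (1 : ℝ≥0) * perG' = (((N : ℕ) : ℝ≥0) * c)⁻¹ • Gp := by
    rw [← hid, inv_smul_smul₀ hNc]
  -- (3) finish: top form free, projection free, one rescaling gate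
  have h1 : complexity Gp ≤ complexity (topComponent w (perG * h)) :=
    IsProjection.complexity_le_holds ⟨prj, hpP, hGp⟩
  have h2 := complexity_topComponent_le w (perG * h)
  have h3 := complexity_smul_le_holds ((((N : ℕ) : ℝ≥0) * c)⁻¹) Gp
  rw [hκ]
  omega

end Summit.ValiantsHypothesis.ValiantsHypothesis.Theorems.DivisionGap.PerMultiplesHard.HostBlockProjection

end
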